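import Literature.Computability.Complexity.SkeletonLayout
import Literature.Computability.Complexity.SkeletonTable
import Literature.Computability.Complexity.TM2ToStackProgram
import Literature.Computability.Complexity.Nondeterministic
import HarnessLib

/-!
# The quasi-linear tableau of a flat stack program, VI: the skeleton reduction of a language

Literature / circuit complexity (serves `williams_acc` through the leaf
`Williams2014_fact_3_1_skeleton`; see `SkeletonTableau.lean`). For the data of an `NTIME[2ⁿ]`
verifier — a flat program `P` with its constants (`SkData`) — this file fixes the parameters of
the tableau per input length (`SkData.tb n`: `Y = c₀ 2ⁿ + c₀` witness slots, `T` machine steps,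
timeline `2^{n + C}`), defines the skeleton `skAll L d n i b` (table mode `SkeletonTable.lean`
below the `L`-dependent length `N₀`, the tableau above), and PROVES every field of
`IsSkeletonReduction c L (skAll L d)` except the running time, for every `c ≥ 7`:
width `≤ 3` (`length_skAll_le`), variables `< 2 ^ succinctWidth c n` (`vars_skAll_lt`),
tautologies beyond (`skAll_taut`), and the correctness `x ∈ L ↔` the presented formula is
satisfiable (`mem_iff_skAll`), from soundness/completeness of the tableau and the verifier's
semantics in flat form (`HFlat`, supplied from `NTIME` membership by `exists_skData`).
-/

namespace Literature.Computability.Complexity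

namespace Tableau

open StackEvents FlatRun Benes _root_.Computability

/-- The data of an `NTIME[2ⁿ]` verifier in flat form: a flat program on `K` registers with input
and output registers, the witness/time constant `c₀` of the verifier and the overhead `e` of
the flat simulation. [folklore] -/
structure SkData where
  /-- number of registers -/
  K : ℕ
  /-- the flat program -/
  P : AProg Bool (Fin K)
  /-- input register -/
  inp : Fin K
  /-- output register -/
  out : Fin K
  /-- constant of the verifier: witnesses `≤ c₀ 2ⁿ + c₀`, time `≤ c₀ 2ⁿ + c₀` -/
  c₀ : ℕ
  /-- overhead of the flat simulation -/
  e : ℕ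

namespace SkData

variable (d : SkData)

/-- Witness slots at length `n`. [folklore] -/
def Y (n : ℕ) : ℕ := d.c₀ * 2 ^ n + d.c₀
/-- Machine steps at length `n`. [folklore] -/
def T (n : ℕ) : ℕ := d.e * (d.c₀ * 2 ^ n + d.c₀ + (2 * n + 2 + d.Y n) + 1) + d.e
/-- The exponent shift: the timeline has length `2 ^ (n + C)`. [folklore] -/
def C : ℕ := 4 * d.c₀ + 6 + d.e * (4 * d.c₀ + 8) + d.e
/-- The tableau parameters at length `n`. [folklore] -/
def tb (n : ℕ) : TabParams := ⟨d.K, d.P, d.inp, d.out, n, d.Y n, d.T n, n + d.C⟩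

/-- `2n + 2 ≤ 4 · 2ⁿ`. [folklore] -/
theorem two_mul_add_two_le (n : ℕ) : 2 * n + 2 ≤ 4 * 2 ^ n := by
  induction n with
  | zero => simp
  | succ n ih => rw [Nat.pow_succ]; omega

/-- The end of the machine phase is before the end of the timeline. [folklore] -/
theorem fit (n : ℕ) : (d.tb n).Send < (d.tb n).S := by
  show d.Y n + (2 * n + 2) + d.T n < 2 ^ (n + d.C)
  have h2 := two_mul_add_two_le n
  have hp : 1 ≤ 2 ^ n := Nat.one_le_two_pow
  have hC : d.C < 2 ^ d.C := Nat.lt_two_pow_self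
  unfold Y T
  have hc1 : d.c₀ ≤ d.c₀ * 2 ^ n := Nat.le_mul_of_pos_right _ hp
  have hE1 : d.e ≤ d.e * 2 ^ n := Nat.le_mul_of_pos_right _ hp
  have hEm : d.e * (2 * n + 2) ≤ d.e * (4 * 2 ^ n) := Nat.mul_le_mul_left _ h2
  have hEc : d.e * d.c₀ ≤ d.e * (d.c₀ * 2 ^ n) := Nat.mul_le_mul_left _ hc1
  have key : d.c₀ * 2 ^ n + d.c₀ + (2 * n + 2) +
      (d.e * (d.c₀ * 2 ^ n + d.c₀ + (2 * n + 2 + (d.c₀ * 2 ^ n + d.c₀)) + 1) + d.e) ≤ d.C * 2 ^ n := by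
    unfold C
    nlinarith [hc1, hE1, hEm, hEc, h2, hp]
  calc _ ≤ d.C * 2 ^ n := key
    _ < 2 ^ d.C * 2 ^ n := Nat.mul_lt_mul_of_pos_right hC (by omega)
    _ = 2 ^ (n + d.C) := by rw [Nat.pow_add, Nat.mul_comm]

/-- The threshold of table mode. [folklore] -/
def N₀ : ℕ := max (8208 * d.K * 2 ^ (d.C + 1)) (max (2 * d.C + 6 + d.P.length) 2)

/-- `9 n³ < 2 ^ (3 log₂ n + 7)`. [folklore] -/
theorem nine_mul_cube_lt (n : ℕ) : 9 * n ^ 3 < 2 ^ (3 * Nat.log 2 n + 7) := by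
  have h : n < 2 ^ (Nat.log 2 n + 1) := Nat.lt_pow_succ_log_self one_lt_two n
  calc 9 * n ^ 3 < 16 * (2 ^ (Nat.log 2 n + 1)) ^ 3 := by
        have : n ^ 3 < (2 ^ (Nat.log 2 n + 1)) ^ 3 := Nat.pow_lt_pow_left h (by decide)
        omega
    _ = 2 ^ (3 * Nat.log 2 n + 7) := by rw [← pow_mul, show (16:ℕ) = 2 ^ 4 by rfl, ← pow_add]; congr 1; ring

/-- **Above `N₀` the tableau fits the succinct width `7`**: `Vtot ≤ 2 ^ succinctWidth 7 n`.
[folklore] -/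
theorem Vtot_lt {n : ℕ} (hn : d.N₀ ≤ n) : (d.tb n).Vtot < 2 ^ succinctWidth 7 n := by
  have hA : 8208 * d.K * 2 ^ (d.C + 1) ≤ n := (le_max_left _ _).trans hn
  have hB : 2 * d.C + 6 + d.P.length ≤ n := ((le_max_left _ _).trans (le_max_right _ _)).trans hn
  have hV : (d.tb n).Vtot = 8208 * (d.K * (2 * 2 ^ (n + d.C) * ((2 * (n + d.C) + 4 + d.P.length + 2) *
      (2 * (n + d.C) + 4 + d.P.length + 2)))) := by
    show 16 * _ + 256 * (32 * _) = _
    unfold TabParams.M TabParams.S2 TabParams.D TabParams.W TabParams.np TabParams.S tb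
    simp only []
    ring
  have h1 : (d.tb n).Vtot ≤ 9 * n ^ 3 * 2 ^ n := by
    rw [hV]
    have hD : 2 * (n + d.C) + 4 + d.P.length + 2 ≤ 3 * n := by omega
    calc 8208 * (d.K * (2 * 2 ^ (n + d.C) * ((2 * (n + d.C) + 4 + d.P.length + 2) *
          (2 * (n + d.C) + 4 + d.P.length + 2))))
        = (8208 * d.K * 2 ^ (d.C + 1)) * 2 ^ n * ((2 * (n + d.C) + 4 + d.P.length + 2) *
          (2 * (n + d.C) + 4 + d.P.length + 2)) := by rw [Nat.pow_add, Nat.pow_succ]; ring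
      _ ≤ n * 2 ^ n * (3 * n * (3 * n)) := by gcongr
      _ = 9 * n ^ 3 * 2 ^ n := by ring
  calc (d.tb n).Vtot ≤ 9 * n ^ 3 * 2 ^ n := h1
    _ < 2 ^ (3 * Nat.log 2 n + 7) * 2 ^ n := Nat.mul_lt_mul_of_pos_right (nine_mul_cube_lt n) (Nat.two_pow_pos n)
    _ ≤ 2 ^ succinctWidth 7 n := by
        rw [← Nat.pow_add]; apply Nat.pow_le_pow_right (by decide); unfold succinctWidth; omega

/-- The meaningful clause indices are fewer than the variable bound. [folklore] -/
theorem NCl_le_Vtot (n : ℕ) : (d.tb n).NCl ≤ (d.tb n).Vtot := by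
  show n + 256 * (32 * _) ≤ 16 * _ + 256 * (32 * _)
  suffices h : n ≤ (d.tb n).M by omega
  unfold TabParams.M TabParams.S2 TabParams.S tb
  simp only []
  have h1 : n < 2 ^ (n + d.C) := (Nat.lt_two_pow_self).trans_le (Nat.pow_le_pow_right (by decide) (by omega))
  have hK : 1 ≤ d.K := d.inp.pos
  have hD : 1 ≤ (d.tb n).D * (d.tb n).D := Nat.one_le_iff_ne_zero.2 (by
    have := D_pos (d.tb n); positivity)
  calc n ≤ 2 * 2 ^ (n + d.C) := by omega
    _ = 1 * (2 * 2 ^ (n + d.C) * 1) := by ring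
    _ ≤ d.K * (2 * 2 ^ (n + d.C) * ((d.tb n).D * (d.tb n).D)) :=
        Nat.mul_le_mul hK (Nat.mul_le_mul_left _ hD)

end SkData

/-! ### Table mode fits every width -/

/-- `n + 2ⁿ (n + 2) < 2 ^ succinctWidth 7 n`. [folklore] -/
theorem CT_lt (n : ℕ) : SkTable.CT n < 2 ^ succinctWidth 7 n := by
  unfold SkTable.CT succinctWidth
  have h1 : n < 2 ^ n := Nat.lt_two_pow_self
  set A := 2 ^ (Nat.log 2 n + 1) with hA
  have hnA : n < A := Nat.lt_pow_succ_log_self one_lt_two n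
  have hA1 : 1 ≤ A := Nat.one_le_two_pow
  have h4 : 2 ^ (Nat.log 2 n + 4) = A * 8 := by
    rw [hA, show Nat.log 2 n + 4 = (Nat.log 2 n + 1) + 3 by ring, Nat.pow_add]
  calc n + 2 ^ n * (n + 2) < 2 ^ n + 2 ^ n * (n + 2) := by omega
    _ = 2 ^ n * (n + 3) := by ring
    _ ≤ 2 ^ n * 2 ^ (Nat.log 2 n + 4) := by
        apply Nat.mul_le_mul_left; rw [h4]; omega
    _ = 2 ^ (n + (Nat.log 2 n + 4)) := (Nat.pow_add 2 n _).symm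
    _ ≤ 2 ^ (n + 7 * Nat.log 2 n + 7) := Nat.pow_le_pow_right (by decide) (by omega)

/-- `VT n ≤ CT n`. [folklore] -/
theorem VT_le_CT (n : ℕ) : SkTable.VT n ≤ SkTable.CT n := by
  unfold SkTable.VT SkTable.CT; gcongr; omega

/-! ### The skeleton of a language -/

section Skeleton

variable (L : Language Bool) (d : SkData)

/-- **The skeleton reduction** for the verifier data `d`: table mode below `N₀`, the tableau
above. [cite: FortnowEtAl2005, §3.1] -/
noncomputable def skAll (n i : ℕ) (b : Bool) : Clause ℕ :=
  if n < d.N₀ then SkTable.skTable L n i b else skTab (d.tb n) i b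

/-- The flat semantics of the verifier: on `⟨x, y⟩` with `|y| ≤ Y |x|` the program reaches the
halting address with `out = [R x y]` within `T |x|` steps. [folklore] -/
def HFlat (R : List Bool → List Bool → Bool) : Prop :=
  ∀ x y : List Bool, y.length ≤ d.Y x.length → ∃ t ≤ d.T x.length,
    (d.P.step^[t]) ⟨0, AStore.single d.inp (boolPair x y)⟩ = ⟨d.P.length, AStore.single d.out [R x y]⟩

variable {L d}

/-- Width at most `3`. [folklore] -/
theorem length_skAll_le (n i : ℕ) (b : Bool) : (skAll L d n i b).length ≤ 3 := by
  unfold skAll; split_ifs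
  · exact SkTable.length_skTable_le L n i b
  · exact length_skTab_le _ i b

/-- Variables below `2 ^ succinctWidth c n` for `c ≥ 7`. [folklore] -/
theorem vars_skAll_lt {c : ℕ} (hc : 7 ≤ c) (n i : ℕ) (b : Bool) :
    ∀ l ∈ skAll L d n i b, l.1 < 2 ^ succinctWidth c n := by
  have hw : 2 ^ succinctWidth 7 n ≤ 2 ^ succinctWidth c n :=
    Nat.pow_le_pow_right (by decide) (succinctWidth_mono hc n)
  intro l hl
  unfold skAll at hl
  split_ifs at hl with h
  · rcases SkTable.vars_skTable_lt L n i b l hl with h1 | h1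
    · exact lt_of_lt_of_le (h1.trans_le ((VT_le_CT n).trans (CT_lt n).le)) hw
    · rw [h1]; exact Nat.two_pow_pos _
  · exact lt_of_lt_of_le ((vars_skTab_lt (d.fit n) i b l hl).trans (d.Vtot_lt (Nat.le_of_not_lt h))) hw

/-- Tautologies from `2 ^ succinctWidth c n` on, `c ≥ 7`. [folklore] -/
theorem skAll_taut {c : ℕ} (hc : 7 ≤ c) {n i : ℕ} (hi : 2 ^ succinctWidth c n ≤ i) (b : Bool) :
    skAll L d n i b = tautClause := by
  have hw : 2 ^ succinctWidth 7 n ≤ 2 ^ succinctWidth c n :=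
    Nat.pow_le_pow_right (by decide) (succinctWidth_mono hc n)
  unfold skAll; split_ifs with h
  · exact SkTable.skTable_taut L n ((CT_lt n).le.trans (hw.trans hi)) b
  · exact skTab_taut _ (((d.NCl_le_Vtot n).trans (d.Vtot_lt (Nat.le_of_not_lt h)).le).trans (hw.trans hi)) b

/-- Satisfiability of the presented formula is satisfiability of all clauses of the skeleton.
[folklore] -/
theorem satisfiable_iff_forall {c : ℕ} (hc : 7 ≤ c) (x : List Bool) :
    (succinctCNF c (skeletonClauses (skAll L d)) x).Satisfiable ↔
      ∃ σ : ℕ → Bool, ∀ i, (skAll L d x.length i (x.getD i false)).eval σ = true := by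
  unfold CNF.Satisfiable
  constructor
  · rintro ⟨σ, hσ⟩
    rw [eval_succinctCNF_eq_true_iff] at hσ
    refine ⟨σ, fun i => ?_⟩
    by_cases hi : i < 2 ^ succinctWidth c x.length
    · exact hσ i hi
    · rw [skAll_taut hc (Nat.le_of_not_lt hi)]; exact eval_tautClause σ
  · rintro ⟨σ, hσ⟩
    exact ⟨σ, eval_succinctCNF_eq_true_iff.2 fun i _ => hσ i⟩

/-- **Correctness of the skeleton**: for a verifier `R` of `L` with flat semantics `HFlat`,
`x ∈ L` iff the presented formula is satisfiable. [cite: FortnowEtAl2005, §3.1] -/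
theorem mem_iff_skAll {R : List Bool → List Bool → Bool} (hR : HFlat d R)
    (hL : ∀ x, x ∈ L ↔ ∃ y : List Bool, y.length ≤ d.c₀ * 2 ^ x.length + d.c₀ ∧ R x y = true)
    {c : ℕ} (hc : 7 ≤ c) (x : List Bool) :
    x ∈ L ↔ (succinctCNF c (skeletonClauses (skAll L d)) x).Satisfiable := by
  rw [satisfiable_iff_forall hc]
  by_cases hn : x.length < d.N₀
  · simp only [skAll, if_pos hn]
    exact (SkTable.sat_skTable_iff L x.length x rfl).symm
  · simp only [skAll, if_neg hn]
    rw [sat_skTab_iff (d.fit x.length)]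
    constructor
    · intro hx
      obtain ⟨y, hy, hRy⟩ := (hL x).1 hx
      obtain ⟨t, ht, hrun⟩ := hR x y hy
      rw [hRy] at hrun
      exact tabOK_complete (tb := d.tb x.length) rfl hy ht hrun
    · rintro ⟨τ, hT, hx⟩
      obtain ⟨y, hy, Rf, hrun, hhead⟩ := tabOK_sound hT (d.fit x.length) (x := x) rfl hx
      obtain ⟨t, ht, hrun'⟩ := hR x y hy
      have hfix : (d.P.step^[(d.tb x.length).T]) ⟨0, AStore.single d.inp (boolPair x y)⟩ =
          ⟨d.P.length, AStore.single d.out [R x y]⟩ := by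
        have hTe : (d.tb x.length).T = d.T x.length := rfl
        have : (d.tb x.length).T = ((d.tb x.length).T - t) + t := by omega
        rw [this, Function.iterate_add_apply, hrun']
        exact d.P.iterate_step_of_le le_rfl _
      have hRf : Rf = AStore.single d.out [R x y] := by
        have := hrun.symm.trans hfix
        cases this; rfl
      rw [hRf] at hhead
      change (AStore.single d.out [R x y] d.out).head? = some true at hhead
      rw [AStore.single_self] at hhead
      simp only [List.head?_cons, Option.some.injEq] at hhead
      exact (hL x).2 ⟨y, hy, hhead⟩

end Skeleton

/-! ### The data of an `NTIME[2ⁿ]` language -/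

/-- **Every `L ∈ NTIME[2ⁿ]` has verifier data with flat semantics.** [folklore] -/
theorem exists_skData {L : Language Bool} (hL : L ∈ NTIME (fun n => 2 ^ n)) :
    ∃ (d : SkData) (R : List Bool → List Bool → Bool), HFlat d R ∧
      ∀ x, x ∈ L ↔ ∃ y : List Bool, y.length ≤ d.c₀ * 2 ^ x.length + d.c₀ ∧ R x y = true := by
  obtain ⟨c₀, R, M, hM, hLR⟩ := hL
  obtain ⟨K, P, inp, out, e, hP⟩ := TM2Flat.exists_aprogFin_of_outputsWithin M
  refine ⟨⟨K, P, inp, out, c₀, e⟩, R, fun x y hy => ?_, hLR⟩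
  obtain ⟨t, ht, hrun⟩ := hP _ _ _ (hM x y hy)
  refine ⟨t, ht.trans ?_, ?_⟩
  · show e * (c₀ * 2 ^ x.length + c₀ + (boolPair x y).length + (encodeBool (R x y)).length) + e ≤
      e * (c₀ * 2 ^ x.length + c₀ + (2 * x.length + 2 + (c₀ * 2 ^ x.length + c₀)) + 1) + e
    have h1 : (boolPair x y).length = 2 * x.length + 2 + y.length := length_boolPair x y
    have h2 : (encodeBool (R x y)).length = 1 := rfl
    have hy' : y.length ≤ c₀ * 2 ^ x.length + c₀ := hy
    rw [h1, h2]
    apply Nat.add_le_add_right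
    apply Nat.mul_le_mul_left
    omega
  · exact hrun

end Tableau

end Literature.Computability.Complexity
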